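import Summits.KontsevichZagierPeriods.KontsevichZagierPeriods.Theses.RootDecompRationalCubeDichotomy
import Literature.ModelTheory.ExponentialFields.SemialgebraicInterior
import Literature.NumberTheory.Transcendental.SemialgebraicAlgebraicPoints
import Mathlib.Analysis.Analytic.IsolatedZeros
import Mathlib.Analysis.Analytic.Uniqueness
import Mathlib.Analysis.Analytic.Polynomial
import Mathlib.Topology.MetricSpace.Thickening
import Mathlib.Algebra.MvPolynomial.Funext
import Mathlib.Data.Fin.SuccPred
import Literature.NumberTheory.Transcendental.KZSemiCanonicalReductionDimOne
import HarnessLib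

/-!
# Route `RootDecompRationalCubeDichotomy`: the `n = 1` slice of item 31659 `NashEtaleLocal` off a finite set

Support file (`--supports stmt-KontsevichZagierPeriods-31659`; companion of the LANDED
`RootDecompRationalCubeDichotomyNashEtaleLocal.lean` (p767855), which proves the edge
`NashEtaleLocal → NashEtaleCover` (31659 → 29430) by name, `local_of_simple` (generic points, any `n`)
and the `n = 0` slice).  Here: `localAt_one_offFinite` — the `n = 1` slice of 31659 OFF A FINITE SET:
a relation `P(x, g x) = 0` of minimal `w`-degree on a rational interval `W ⊇ [0,1]`; `∂_w P(x, g x)` is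
analytic and not identically zero on `W`, hence has finitely many zeros on `[0,1]` (identity principle
along the graph); `local_of_simple` elsewhere.  What remains of the `n = 1` slice is the construction at
these finitely many `P`-ramified (algebraic) points (Dedekind: `e = 1`, Stacks 00UE).

Source: cell `decomp-kz`, lens 2, gen 7, landing package
`HOME/decomp-kz-lens-2/g7/landing/RootDecompRationalCubeDichotomyNashEtaleSlices.lean` sha256 5355abce418affd9
(critic decomp-kz-crit-1 g2 CLEARED 2026-08-30T09:29:32Z, std axioms on `localAt_one_offFinite`), with the
two already-landed theorems removed (`local_of_simple` kept as a PRIVATE copy; the auxiliary interval `W ε` inlined);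
landed by the census seat decomp-kz-census-1 g7.  No `sorry`; no `def : Prop`; standard axioms.
References: J. Bochnak, M. Coste, M.-F. Roy, *Real Algebraic Geometry* (1998), §2.8, §8.1
[cite: BochnakCosteRoy1998, §8.1]; Stacks 00UE.
-/

open Set MvPolynomial
open Literature.NumberTheory.Transcendental

namespace Summit.KontsevichZagierPeriods.RootDecompRationalCubeDichotomy.Rung29430.NashEtaleLocalOne

open Summit.KontsevichZagierPeriods.KontsevichZagierPeriods.Theses.RootDecompRationalCubeDichotomy
  (NashEtaleCover NashEtaleLocal)

/-- (Private copy of the landed `…Rung29430.NashEtaleLocalGlue.local_of_simple` (p767855), kept here so that this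
file does not import a Theorems module that imports the route file — theses-cone lint.) **Generic points.**  At a point `x₀` where some `P ∈ ℚ[x][w]` vanishing on the graph of `g` over `U`
is already SIMPLE (`∂_w P(x₀, g x₀) ≠ 0`), the pointwise étale re-presentation holds with `h = g`,
`F = P`, `A = w`, `B = 1` on `V = U ∩ {∂_w P(x, g x) ≠ 0}`.  So the content of `NashEtaleLocal` sits at
the `P`-ramified points only (for `n = 1`: finitely many algebraic `x₀`, NODE §C). [folklore] -/
private theorem local_of_simple {n : ℕ} {g : (Fin n → ℝ) → ℝ} {U : Set (Fin n → ℝ)} (hU : IsOpen U)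
    (hsa : IsSemialgebraicFunOn ℚ U g) (han : AnalyticOnNhd ℝ g U) {x₀ : Fin n → ℝ} (hx₀ : x₀ ∈ U)
    (P : MvPolynomial (Fin (n + 1)) ℚ)
    (hP : ∀ x ∈ U, MvPolynomial.aeval (Fin.snoc x (g x) : Fin (n + 1) → ℝ) P = 0)
    (hPt : MvPolynomial.aeval (Fin.snoc x₀ (g x₀) : Fin (n + 1) → ℝ)
      (MvPolynomial.pderiv (Fin.last n) P) ≠ 0) :
    ∃ (V : Set (Fin n → ℝ)) (h : (Fin n → ℝ) → ℝ) (F A B : MvPolynomial (Fin (n + 1)) ℚ),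
      IsOpen V ∧ x₀ ∈ V ∧ IsSemialgebraicFunOn ℚ V h ∧ AnalyticOnNhd ℝ h V ∧
      ∀ x ∈ V,
        MvPolynomial.aeval (Fin.snoc x (h x) : Fin (n + 1) → ℝ) F = 0 ∧
        MvPolynomial.aeval (Fin.snoc x (h x) : Fin (n + 1) → ℝ) (MvPolynomial.pderiv (Fin.last n) F) ≠ 0 ∧
        MvPolynomial.aeval (Fin.snoc x (h x) : Fin (n + 1) → ℝ) B ≠ 0 ∧
        g x = MvPolynomial.aeval (Fin.snoc x (h x) : Fin (n + 1) → ℝ) A /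
          MvPolynomial.aeval (Fin.snoc x (h x) : Fin (n + 1) → ℝ) B := by
  set Pt := MvPolynomial.pderiv (Fin.last n) P with hPt_def
  set φ : (Fin n → ℝ) → ℝ := fun x => MvPolynomial.aeval (Fin.snoc x (g x) : Fin (n + 1) → ℝ) Pt
    with hφ
  have hφc : ContinuousOn φ U := by
    have hc : Continuous (fun z : Fin (n + 1) → ℝ => MvPolynomial.aeval z Pt) :=
      continuousOn_univ.mp
        (Literature.ModelTheory.ExponentialFields.analyticOnNhd_aeval Pt).continuousOn
    exact hc.comp_continuousOn
      (ContinuousOn.finSnoc (X := fun _ : Fin (n + 1) => ℝ) continuousOn_id han.continuousOn)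
  refine ⟨U ∩ φ ⁻¹' {c | c ≠ 0}, g, P, X (Fin.last n), 1,
    hφc.isOpen_inter_preimage hU isOpen_ne, ⟨hx₀, hPt⟩, ?_, han.mono inter_subset_left, ?_⟩
  · -- the graph over `V` is the graph over `U` cut by `∂_w P ≠ 0`
    have hset : {z : Fin (n + 1) → ℝ | ∃ x ∈ U ∩ φ ⁻¹' {c | c ≠ 0}, z = Fin.snoc x (g x)} =
        {z : Fin (n + 1) → ℝ | ∃ x ∈ U, z = Fin.snoc x (g x)} ∩
          {z : Fin (n + 1) → ℝ | MvPolynomial.aeval z Pt = 0}ᶜ := by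
      ext z
      simp only [mem_setOf_eq, mem_inter_iff, mem_preimage, mem_compl_iff]
      constructor
      · rintro ⟨x, ⟨hxU, hxφ⟩, rfl⟩
        exact ⟨⟨x, hxU, rfl⟩, hxφ⟩
      · rintro ⟨⟨x, hxU, rfl⟩, hz⟩
        exact ⟨x, ⟨hxU, hz⟩, rfl⟩
    unfold IsSemialgebraicFunOn
    rw [hset]
    exact hsa.inter
      (Literature.ModelTheory.ExponentialFields.isSemialgebraic_setOf_eval_eq_zero Pt).compl
  · rintro x ⟨hxU, hxφ⟩
    refine ⟨hP x hxU, hxφ, by simp, ?_⟩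
    simp

/-! ## The `n = 1` slice off a finite set

For `n = 1` the pointwise data exist at every point of `[0,1]` outside a FINITE set: take a non-zero
`P ∈ ℚ[x][w]` vanishing on the graph of `g` over a rational open interval `W ⊇ [0,1]` inside `U`
(`exists_mvPolynomial_relation`) of minimal `w`-degree; `∂_w P(x, g x)` is analytic on `W` and not
identically zero (else `∂_w P` would be a relation of smaller `w`-degree), so it has finitely many
zeros on the compact `[0,1]` (isolated zeros + identity principle), and `local_of_simple` applies off
them.  What is left of the `n = 1` slice of 31659 is the construction at these finitely many `P`-ramified
points (NODE §C). -/

section OffFinite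

open Filter Topology
open Literature.ModelTheory.ExponentialFields (IsSemialgebraic isSemialgebraic_setOf_eval_pos
  continuous_aeval_real)

/-- **Polynomial relation** (= `LiftingCriteria.CubeNashNormalFormPuiseux.exists_mvPolynomial_relation`
of `Theorems/LiftingCriteriaCubeNashNormalFormPuiseuxAtlas.lean`, reproduced as a PRIVATE copy because that
module is unbuilt on the farm snapshot (dedup.landed otherwise)).  A `ℚ`-semialgebraic function of one variable satisfies a non-trivial polynomial
relation `P(x, f x) = 0`, `0 ≠ P ∈ ℚ[X₀, X₁]`: its graph has empty interior, hence lies in finitely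
many proper zero sets (`IsSemialgebraic.subset_interior_union`). [Bochnak–Coste–Roy 1998, §2.8]
[folklore] -/
private theorem exists_mvPolynomial_relation {S : Set (Fin 1 → ℝ)} {f : (Fin 1 → ℝ) → ℝ}
    (hf : IsSemialgebraicFunOn ℚ S f) :
    ∃ P : MvPolynomial (Fin (1 + 1)) ℚ, P ≠ 0 ∧
      ∀ x ∈ S, MvPolynomial.aeval (Fin.snoc x (f x) : Fin (1 + 1) → ℝ) P = 0 := by
  classical
  set G : Set (Fin (1 + 1) → ℝ) := {z | ∃ x ∈ S, z = Fin.snoc x (f x)} with hG_def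
  have hG : IsSemialgebraic ℚ G := hf
  have hint : interior G = ∅ := by
    refine Set.eq_empty_iff_forall_notMem.mpr fun z hz => ?_
    obtain ⟨ε, hε, hball⟩ := Metric.mem_nhds_iff.mp (mem_interior_iff_mem_nhds.mp hz)
    obtain ⟨x, -, hzx⟩ := interior_subset hz
    set z' : Fin (1 + 1) → ℝ := Function.update z (Fin.last 1) (z (Fin.last 1) + ε / 2) with hz'
    have hz'ball : z' ∈ Metric.ball z ε := by
      rw [Metric.mem_ball, dist_pi_lt_iff hε]
      intro b
      by_cases hb : b = Fin.last 1
      · subst hb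
        rw [hz', Function.update_self, Real.dist_eq,
          show z (Fin.last 1) + ε / 2 - z (Fin.last 1) = ε / 2 by ring, abs_of_pos (by linarith)]
        linarith
      · rw [hz', Function.update_of_ne hb, dist_self]
        exact hε
    obtain ⟨x', -, hz'x⟩ := hball hz'ball
    have h1 : Fin.init z' = Fin.init z := by
      rw [hz']
      exact Fin.init_update_last _ _
    have hx : Fin.init z = x := by rw [hzx, Fin.init_snoc]
    have hx' : Fin.init z' = x' := by rw [hz'x, Fin.init_snoc]
    have hxx' : x' = x := by rw [← hx', h1, hx]
    have hlast : z' (Fin.last 1) = z (Fin.last 1) := by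
      rw [hz'x, hzx, Fin.snoc_last, Fin.snoc_last, hxx']
    rw [hz', Function.update_self] at hlast
    linarith
  obtain ⟨Q₀, hQ₀, hsub⟩ := hG.subset_interior_union
  rw [hint, Set.empty_union] at hsub
  refine ⟨∏ q ∈ Q₀, q, Finset.prod_ne_zero_iff.mpr fun q hq h0 => ?_, fun x hx => ?_⟩
  · obtain ⟨y, hy⟩ := hQ₀ q hq
    exact hy (by rw [h0, map_zero])
  · have hz : (Fin.snoc x (f x) : Fin (1 + 1) → ℝ) ∈ G := ⟨x, hx, rfl⟩
    obtain ⟨q, hq, hq0⟩ : ∃ q ∈ Q₀, MvPolynomial.aeval (Fin.snoc x (f x) : Fin (1 + 1) → ℝ) q = 0 := by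
      simpa only [Set.mem_iUnion, Set.mem_setOf_eq, exists_prop] using hsub hz
    rw [map_prod]
    exact Finset.prod_eq_zero hq hq0

/-- Membership in the open rational interval `(-ε, 1 + ε)` of the line, written as the sign-condition set
`{0 < X 0 + ε} ∩ {0 < (1 + ε) − X 0}` (kept inline, no auxiliary definition). -/
theorem mem_W_iff {ε : ℚ} {x : Fin 1 → ℝ} : x ∈ ({x : Fin 1 → ℝ | 0 < MvPolynomial.aeval x (X 0 + C ε : MvPolynomial (Fin 1) ℚ)} ∩ {x : Fin 1 → ℝ | 0 < MvPolynomial.aeval x (C (1 + ε) - X 0 : MvPolynomial (Fin 1) ℚ)}) ↔ -(ε : ℝ) < x 0 ∧ x 0 < 1 + ε := by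
  simp only [Set.mem_inter_iff, Set.mem_setOf_eq, map_add, map_sub, MvPolynomial.aeval_X,
    MvPolynomial.aeval_C, eq_ratCast, Rat.cast_one]
  constructor <;> rintro ⟨h1, h2⟩ <;> constructor <;> linarith

/-- `({x : Fin 1 → ℝ | 0 < MvPolynomial.aeval x (X 0 + C ε : MvPolynomial (Fin 1) ℚ)} ∩ {x : Fin 1 → ℝ | 0 < MvPolynomial.aeval x (C (1 + ε) - X 0 : MvPolynomial (Fin 1) ℚ)})` is `ℚ`-semialgebraic. -/
theorem isSemialgebraic_W (ε : ℚ) : IsSemialgebraic ℚ (({x : Fin 1 → ℝ | 0 < MvPolynomial.aeval x (X 0 + C ε : MvPolynomial (Fin 1) ℚ)} ∩ {x : Fin 1 → ℝ | 0 < MvPolynomial.aeval x (C (1 + ε) - X 0 : MvPolynomial (Fin 1) ℚ)})) :=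
  (isSemialgebraic_setOf_eval_pos _).inter (isSemialgebraic_setOf_eval_pos _)

/-- `({x : Fin 1 → ℝ | 0 < MvPolynomial.aeval x (X 0 + C ε : MvPolynomial (Fin 1) ℚ)} ∩ {x : Fin 1 → ℝ | 0 < MvPolynomial.aeval x (C (1 + ε) - X 0 : MvPolynomial (Fin 1) ℚ)})` is open. -/
theorem isOpen_W (ε : ℚ) : IsOpen (({x : Fin 1 → ℝ | 0 < MvPolynomial.aeval x (X 0 + C ε : MvPolynomial (Fin 1) ℚ)} ∩ {x : Fin 1 → ℝ | 0 < MvPolynomial.aeval x (C (1 + ε) - X 0 : MvPolynomial (Fin 1) ℚ)})) :=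
  (isOpen_lt continuous_const (continuous_aeval_real _)).inter
    (isOpen_lt continuous_const (continuous_aeval_real _))

/-- For a small positive rational `ε`, `(-ε, 1 + ε) ⊆ U` whenever `U` is an open neighbourhood of
`[0,1]`. -/
theorem exists_W_subset {U : Set (Fin 1 → ℝ)} (hU : IsOpen U)
    (hKU : Set.pi Set.univ (fun _ : Fin 1 => Set.Icc (0:ℝ) 1) ⊆ U) :
    ∃ ε : ℚ, 0 < ε ∧ ({x : Fin 1 → ℝ | 0 < MvPolynomial.aeval x (X 0 + C ε : MvPolynomial (Fin 1) ℚ)} ∩ {x : Fin 1 → ℝ | 0 < MvPolynomial.aeval x (C (1 + ε) - X 0 : MvPolynomial (Fin 1) ℚ)}) ⊆ U := by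
  obtain ⟨δ, hδ, hδU⟩ :=
    (isCompact_univ_pi fun _ : Fin 1 => isCompact_Icc).exists_cthickening_subset_open hU hKU
  obtain ⟨ε, hε0, hεδ⟩ := exists_rat_btwn hδ
  refine ⟨ε, by exact_mod_cast hε0, fun x hx => hδU ?_⟩
  obtain ⟨h1, h2⟩ := mem_W_iff.mp hx
  set y : Fin 1 → ℝ := fun _ => max 0 (min 1 (x 0)) with hy
  have hyK : y ∈ Set.pi Set.univ (fun _ : Fin 1 => Set.Icc (0:ℝ) 1) := fun i _ =>
    ⟨le_max_left _ _, max_le zero_le_one (min_le_left _ _)⟩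
  have hdist : dist x y ≤ ε := by
    rw [dist_pi_le_iff (by exact_mod_cast hε0.le)]
    intro i
    rw [Subsingleton.elim i 0, Real.dist_eq, abs_le]
    have hy0 : y 0 = max 0 (min 1 (x 0)) := rfl
    rw [hy0]
    rcases le_total 0 (x 0) with h0 | h0
    · rcases le_total (x 0) 1 with h1' | h1'
      · rw [min_eq_right h1', max_eq_right h0]; constructor <;> linarith
      · rw [min_eq_left h1', max_eq_right zero_le_one]; constructor <;> linarith
    · rw [min_eq_right (h0.trans zero_le_one), max_eq_left h0]; constructor <;> linarith
  exact Metric.mem_cthickening_of_dist_le x y δ _ hyK (hdist.trans hεδ.le)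

/-- Polynomial expressions in `(x, g x)` are analytic where `g` is. -/
theorem analyticOnNhd_aeval_snoc {n : ℕ} {g : (Fin n → ℝ) → ℝ} {U : Set (Fin n → ℝ)}
    (han : AnalyticOnNhd ℝ g U) (Q : MvPolynomial (Fin (n + 1)) ℚ) :
    AnalyticOnNhd ℝ (fun x => MvPolynomial.aeval (Fin.snoc x (g x) : Fin (n + 1) → ℝ) Q) U := by
  intro x hx
  refine AnalyticAt.aeval_mvPolynomial (fun i => ?_) Q
  refine Fin.lastCases ?_ (fun j => ?_) i
  · simp only [Fin.snoc_last]
    exact han x hx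
  · simp only [Fin.snoc_castSucc]
    exact (ContinuousLinearMap.proj (R := ℝ) (φ := fun _ : Fin n => ℝ) j).analyticAt x

/-- Polynomial maps `ℝ¹ → ℝ` with rational coefficients are analytic. -/
theorem analyticOnNhd_aeval_one (Q : MvPolynomial (Fin 1) ℚ) :
    AnalyticOnNhd ℝ (fun x : Fin 1 → ℝ => MvPolynomial.aeval x Q) Set.univ := fun x _ =>
  AnalyticAt.aeval_mvPolynomial
    (fun j => (ContinuousLinearMap.proj (R := ℝ) (φ := fun _ : Fin 1 => ℝ) j).analyticAt x) Q

/-- **Identity principle along the graph.** If `x ↦ Q(x, g x)` (`g` analytic on `({x : Fin 1 → ℝ | 0 < MvPolynomial.aeval x (X 0 + C ε : MvPolynomial (Fin 1) ℚ)} ∩ {x : Fin 1 → ℝ | 0 < MvPolynomial.aeval x (C (1 + ε) - X 0 : MvPolynomial (Fin 1) ℚ)})`) vanishes at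
infinitely many points of `[0,1]`, it vanishes on all of `({x : Fin 1 → ℝ | 0 < MvPolynomial.aeval x (X 0 + C ε : MvPolynomial (Fin 1) ℚ)} ∩ {x : Fin 1 → ℝ | 0 < MvPolynomial.aeval x (C (1 + ε) - X 0 : MvPolynomial (Fin 1) ℚ)})`. -/
theorem aeval_snoc_eq_zero_of_infinite {ε : ℚ} (hε : 0 < ε) {g : (Fin 1 → ℝ) → ℝ}
    (han : AnalyticOnNhd ℝ g (({x : Fin 1 → ℝ | 0 < MvPolynomial.aeval x (X 0 + C ε : MvPolynomial (Fin 1) ℚ)} ∩ {x : Fin 1 → ℝ | 0 < MvPolynomial.aeval x (C (1 + ε) - X 0 : MvPolynomial (Fin 1) ℚ)}))) (Q : MvPolynomial (Fin (1 + 1)) ℚ)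
    (hinf : {x | x ∈ Set.pi Set.univ (fun _ : Fin 1 => Set.Icc (0:ℝ) 1) ∧
      MvPolynomial.aeval (Fin.snoc x (g x) : Fin (1 + 1) → ℝ) Q = 0}.Infinite) :
    ∀ x ∈ ({x : Fin 1 → ℝ | 0 < MvPolynomial.aeval x (X 0 + C ε : MvPolynomial (Fin 1) ℚ)} ∩ {x : Fin 1 → ℝ | 0 < MvPolynomial.aeval x (C (1 + ε) - X 0 : MvPolynomial (Fin 1) ℚ)}), MvPolynomial.aeval (Fin.snoc x (g x) : Fin (1 + 1) → ℝ) Q = 0 := by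
  have hε' : (0:ℝ) < ε := by exact_mod_cast hε
  set φ : (Fin 1 → ℝ) → ℝ := fun x => MvPolynomial.aeval (Fin.snoc x (g x) : Fin (1 + 1) → ℝ) Q
    with hφdef
  set ψ : ℝ → ℝ := fun t => φ (fun _ => t) with hψdef
  have hφan : AnalyticOnNhd ℝ φ (({x : Fin 1 → ℝ | 0 < MvPolynomial.aeval x (X 0 + C ε : MvPolynomial (Fin 1) ℚ)} ∩ {x : Fin 1 → ℝ | 0 < MvPolynomial.aeval x (C (1 + ε) - X 0 : MvPolynomial (Fin 1) ℚ)})) := analyticOnNhd_aeval_snoc han Q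
  have hι : ∀ t : ℝ, AnalyticAt ℝ (fun s : ℝ => (fun _ : Fin 1 => s)) t := fun t =>
    AnalyticAt.pi fun _ => analyticAt_id
  have hψan : AnalyticOnNhd ℝ ψ (Set.Ioo (-(ε:ℝ)) (1 + ε)) := by
    intro t ht
    have hmem : (fun _ : Fin 1 => t) ∈ ({x : Fin 1 → ℝ | 0 < MvPolynomial.aeval x (X 0 + C ε : MvPolynomial (Fin 1) ℚ)} ∩ {x : Fin 1 → ℝ | 0 < MvPolynomial.aeval x (C (1 + ε) - X 0 : MvPolynomial (Fin 1) ℚ)}) := mem_W_iff.mpr ht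
    have hc : AnalyticAt ℝ (φ ∘ fun s : ℝ => (fun _ : Fin 1 => s)) t :=
      AnalyticAt.comp (hφan _ hmem) (hι t)
    exact hc
  have hφψ : ∀ x : Fin 1 → ℝ, φ x = ψ (x 0) := by
    intro x
    rw [hψdef]
    simp only
    rw [← KZ.eq_const_apply_zero x]
  set Z : Set ℝ := (fun x : Fin 1 → ℝ => x 0) ''
    {x | x ∈ Set.pi Set.univ (fun _ : Fin 1 => Set.Icc (0:ℝ) 1) ∧ φ x = 0} with hZ
  have hinj : Set.InjOn (fun x : Fin 1 → ℝ => x 0)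
      {x | x ∈ Set.pi Set.univ (fun _ : Fin 1 => Set.Icc (0:ℝ) 1) ∧ φ x = 0} := by
    intro x _ y _ hxy
    rw [KZ.eq_const_apply_zero x, KZ.eq_const_apply_zero y]
    simp only at hxy
    rw [hxy]
  have hZinf : Z.Infinite := (Set.infinite_image_iff hinj).mpr hinf
  have hZK : Z ⊆ Set.Icc (0:ℝ) 1 := by
    rintro _ ⟨x, ⟨hxK, -⟩, rfl⟩
    exact hxK 0 (Set.mem_univ _)
  have hZψ : ∀ t ∈ Z, ψ t = 0 := by
    rintro _ ⟨x, ⟨-, hx0⟩, rfl⟩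
    rw [← hφψ]
    exact hx0
  obtain ⟨t₀, ht₀K, hacc⟩ := hZinf.exists_accPt_of_subset_isCompact isCompact_Icc hZK
  have ht₀I : t₀ ∈ Set.Ioo (-(ε:ℝ)) (1 + ε) := ⟨by linarith [ht₀K.1], by linarith [ht₀K.2]⟩
  have hev : ∀ᶠ z in 𝓝 t₀, ψ z = 0 := by
    rcases (hψan t₀ ht₀I).eventually_eq_zero_or_eventually_ne_zero with h | h
    · exact h
    · exfalso
      rw [accPt_iff_frequently] at hacc
      have h' : ∀ᶠ z in 𝓝 t₀, z ∈ ({t₀}ᶜ : Set ℝ) → ψ z ≠ 0 := eventually_nhdsWithin_iff.mp h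
      obtain ⟨z, ⟨hz1, hz2⟩, hz3⟩ := (hacc.and_eventually h').exists
      exact hz3 (Set.mem_compl_singleton_iff.mpr hz1) (hZψ z hz2)
  have hall := hψan.eqOn_zero_of_preconnected_of_eventuallyEq_zero isPreconnected_Ioo ht₀I hev
  intro x hx
  have h := hall (mem_W_iff.mp hx)
  simp only [Pi.zero_apply] at h
  rw [← hφψ] at h
  exact h

/-- **The `n = 1` slice of the pointwise form holds off a finite set.**  There are a rational open
interval `W ⊇ [0,1]` inside `U` and a non-zero `P ∈ ℚ[x][w]` with `P(x, g x) = 0` on `W` such that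
`∂_w P(x, g x)` has only finitely many zeros on `[0,1]`; at every other point of `[0,1]` the
slice-`n = 1` data of 31659 exist (`h = g`, `F = P`, `A = w`, `B = 1`). [folklore] -/
theorem localAt_one_offFinite (g : (Fin 1 → ℝ) → ℝ) (U : Set (Fin 1 → ℝ)) (hU : IsOpen U)
    (hKU : Set.pi Set.univ (fun _ : Fin 1 => Set.Icc (0:ℝ) 1) ⊆ U)
    (hsa : IsSemialgebraicFunOn ℚ U g) (han : AnalyticOnNhd ℝ g U) :
    ∃ (P : MvPolynomial (Fin (1 + 1)) ℚ), P ≠ 0 ∧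
      (∀ x ∈ Set.pi Set.univ (fun _ : Fin 1 => Set.Icc (0:ℝ) 1),
        MvPolynomial.aeval (Fin.snoc x (g x) : Fin (1 + 1) → ℝ) P = 0) ∧
      {x | x ∈ Set.pi Set.univ (fun _ : Fin 1 => Set.Icc (0:ℝ) 1) ∧
        MvPolynomial.aeval (Fin.snoc x (g x) : Fin (1 + 1) → ℝ)
          (MvPolynomial.pderiv (Fin.last 1) P) = 0}.Finite ∧
      ∀ x₀ ∈ Set.pi Set.univ (fun _ : Fin 1 => Set.Icc (0:ℝ) 1),
        MvPolynomial.aeval (Fin.snoc x₀ (g x₀) : Fin (1 + 1) → ℝ)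
          (MvPolynomial.pderiv (Fin.last 1) P) ≠ 0 →
        ∃ (V : Set (Fin 1 → ℝ)) (h : (Fin 1 → ℝ) → ℝ) (F A B : MvPolynomial (Fin (1 + 1)) ℚ),
          IsOpen V ∧ x₀ ∈ V ∧ IsSemialgebraicFunOn ℚ V h ∧ AnalyticOnNhd ℝ h V ∧
          ∀ x ∈ V,
            MvPolynomial.aeval (Fin.snoc x (h x) : Fin (1 + 1) → ℝ) F = 0 ∧
            MvPolynomial.aeval (Fin.snoc x (h x) : Fin (1 + 1) → ℝ)
              (MvPolynomial.pderiv (Fin.last 1) F) ≠ 0 ∧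
            MvPolynomial.aeval (Fin.snoc x (h x) : Fin (1 + 1) → ℝ) B ≠ 0 ∧
            g x = MvPolynomial.aeval (Fin.snoc x (h x) : Fin (1 + 1) → ℝ) A /
              MvPolynomial.aeval (Fin.snoc x (h x) : Fin (1 + 1) → ℝ) B := by
  classical
  obtain ⟨ε, hε, hWU⟩ := exists_W_subset hU hKU
  have hε' : (0:ℝ) < ε := by exact_mod_cast hε
  have hWo : IsOpen (({x : Fin 1 → ℝ | 0 < MvPolynomial.aeval x (X 0 + C ε : MvPolynomial (Fin 1) ℚ)} ∩ {x : Fin 1 → ℝ | 0 < MvPolynomial.aeval x (C (1 + ε) - X 0 : MvPolynomial (Fin 1) ℚ)})) := isOpen_W ε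
  have hKW : Set.pi Set.univ (fun _ : Fin 1 => Set.Icc (0:ℝ) 1) ⊆ ({x : Fin 1 → ℝ | 0 < MvPolynomial.aeval x (X 0 + C ε : MvPolynomial (Fin 1) ℚ)} ∩ {x : Fin 1 → ℝ | 0 < MvPolynomial.aeval x (C (1 + ε) - X 0 : MvPolynomial (Fin 1) ℚ)}) := fun x hx => by
    have h0 := hx 0 (Set.mem_univ _)
    rw [Set.mem_Icc] at h0
    exact mem_W_iff.mpr ⟨by linarith [h0.1], by linarith [h0.2]⟩
  have hsaW : IsSemialgebraicFunOn ℚ (({x : Fin 1 → ℝ | 0 < MvPolynomial.aeval x (X 0 + C ε : MvPolynomial (Fin 1) ℚ)} ∩ {x : Fin 1 → ℝ | 0 < MvPolynomial.aeval x (C (1 + ε) - X 0 : MvPolynomial (Fin 1) ℚ)})) g := hsa.mono hWU (isSemialgebraic_W ε)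
  have hanW : AnalyticOnNhd ℝ g (({x : Fin 1 → ℝ | 0 < MvPolynomial.aeval x (X 0 + C ε : MvPolynomial (Fin 1) ℚ)} ∩ {x : Fin 1 → ℝ | 0 < MvPolynomial.aeval x (C (1 + ε) - X 0 : MvPolynomial (Fin 1) ℚ)})) := han.mono hWU
  -- a relation of minimal `w`-degree
  have hR : ∃ d : ℕ, ∃ P : MvPolynomial (Fin (1 + 1)) ℚ, P ≠ 0 ∧
      (∀ x ∈ ({x : Fin 1 → ℝ | 0 < MvPolynomial.aeval x (X 0 + C ε : MvPolynomial (Fin 1) ℚ)} ∩ {x : Fin 1 → ℝ | 0 < MvPolynomial.aeval x (C (1 + ε) - X 0 : MvPolynomial (Fin 1) ℚ)}), MvPolynomial.aeval (Fin.snoc x (g x) : Fin (1 + 1) → ℝ) P = 0) ∧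
      P.degreeOf (Fin.last 1) = d := by
    obtain ⟨P, hP0, hP⟩ := exists_mvPolynomial_relation hsaW
    exact ⟨_, P, hP0, hP, rfl⟩
  obtain ⟨P, hP0, hP, hPd⟩ := Nat.find_spec hR
  have hmin : ∀ Q : MvPolynomial (Fin (1 + 1)) ℚ, Q ≠ 0 →
      (∀ x ∈ ({x : Fin 1 → ℝ | 0 < MvPolynomial.aeval x (X 0 + C ε : MvPolynomial (Fin 1) ℚ)} ∩ {x : Fin 1 → ℝ | 0 < MvPolynomial.aeval x (C (1 + ε) - X 0 : MvPolynomial (Fin 1) ℚ)}), MvPolynomial.aeval (Fin.snoc x (g x) : Fin (1 + 1) → ℝ) Q = 0) →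
      P.degreeOf (Fin.last 1) ≤ Q.degreeOf (Fin.last 1) := by
    intro Q hQ0 hQ
    rw [hPd]
    exact Nat.find_min' hR ⟨Q, hQ0, hQ, rfl⟩
  -- `P` involves `w`
  have hdeg : P.degreeOf (Fin.last 1) ≠ 0 := by
    intro h0
    have hvars : (↑P.vars : Set (Fin (1 + 1))) ⊆ Set.range (Fin.castSucc : Fin 1 → Fin (1 + 1)) := by
      intro i hi
      rcases Fin.eq_castSucc_or_eq_last i with ⟨j, rfl⟩ | rfl
      · exact ⟨j, rfl⟩
      · exact absurd h0 (MvPolynomial.mem_vars_iff_degreeOf_ne_zero.mp (Finset.mem_coe.mp hi))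
    obtain ⟨P₀, hP₀⟩ := MvPolynomial.exists_rename_eq_of_vars_subset_range P Fin.castSucc
      (Fin.castSucc_injective 1) hvars
    have hP₀0 : P₀ ≠ 0 := by
      rintro rfl
      exact hP0 (by rw [← hP₀, map_zero])
    have hP₀W : ∀ x ∈ ({x : Fin 1 → ℝ | 0 < MvPolynomial.aeval x (X 0 + C ε : MvPolynomial (Fin 1) ℚ)} ∩ {x : Fin 1 → ℝ | 0 < MvPolynomial.aeval x (C (1 + ε) - X 0 : MvPolynomial (Fin 1) ℚ)}), MvPolynomial.aeval x P₀ = 0 := by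
      intro x hx
      have h := hP x hx
      rwa [← hP₀, MvPolynomial.aeval_rename, Fin.snoc_comp_castSucc] at h
    have hx₁ : (fun _ : Fin 1 => (1 / 2 : ℝ)) ∈ ({x : Fin 1 → ℝ | 0 < MvPolynomial.aeval x (X 0 + C ε : MvPolynomial (Fin 1) ℚ)} ∩ {x : Fin 1 → ℝ | 0 < MvPolynomial.aeval x (C (1 + ε) - X 0 : MvPolynomial (Fin 1) ℚ)}) := mem_W_iff.mpr ⟨by norm_num; linarith, by norm_num; linarith⟩
    have hev : (fun x : Fin 1 → ℝ => MvPolynomial.aeval x P₀) =ᶠ[𝓝 (fun _ : Fin 1 => (1 / 2 : ℝ))] 0 :=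
      Filter.eventuallyEq_iff_exists_mem.mpr ⟨({x : Fin 1 → ℝ | 0 < MvPolynomial.aeval x (X 0 + C ε : MvPolynomial (Fin 1) ℚ)} ∩ {x : Fin 1 → ℝ | 0 < MvPolynomial.aeval x (C (1 + ε) - X 0 : MvPolynomial (Fin 1) ℚ)}), hWo.mem_nhds hx₁, fun x hx => hP₀W x hx⟩
    have hall := (analyticOnNhd_aeval_one P₀).eqOn_zero_of_preconnected_of_eventuallyEq_zero
      isPreconnected_univ (Set.mem_univ _) hev
    have hmap : MvPolynomial.map (algebraMap ℚ ℝ) P₀ = 0 := MvPolynomial.funext fun x => by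
      rw [MvPolynomial.eval_map, map_zero]
      have h := hall (Set.mem_univ x)
      simp only [Pi.zero_apply] at h
      exact h
    exact hP₀0 (MvPolynomial.map_injective (algebraMap ℚ ℝ) (algebraMap ℚ ℝ).injective
      (by rw [hmap, map_zero]))
  -- the `w`-derivative has smaller `w`-degree and is non-zero
  set Pw := MvPolynomial.pderiv (Fin.last 1) P with hPw
  have hdeglt : Pw.degreeOf (Fin.last 1) < P.degreeOf (Fin.last 1) := by
    rw [MvPolynomial.degreeOf_lt_iff (Nat.pos_of_ne_zero hdeg)]
    intro m hm
    rw [MvPolynomial.mem_support_iff, hPw, MvPolynomial.coeff_pderiv] at hm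
    have hm' : m + Finsupp.single (Fin.last 1) 1 ∈ P.support := by
      rw [MvPolynomial.mem_support_iff]
      intro h0
      exact hm (by rw [h0, zero_mul])
    have h := MvPolynomial.monomial_le_degreeOf (Fin.last 1) hm'
    simp only [Finsupp.coe_add, Pi.add_apply, Finsupp.single_eq_same] at h
    omega
  have hPw0 : Pw ≠ 0 := by
    intro h0
    apply hdeg
    apply Nat.le_zero.mp
    rw [MvPolynomial.degreeOf_le_iff]
    intro m hm
    by_contra hmpos
    have hmpos' : 1 ≤ m (Fin.last 1) := by omega
    have hcoef := MvPolynomial.coeff_pderiv (i := Fin.last 1) P (m - Finsupp.single (Fin.last 1) 1)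
    rw [← hPw, h0, MvPolynomial.coeff_zero] at hcoef
    have hms : m - Finsupp.single (Fin.last 1) 1 + Finsupp.single (Fin.last 1) 1 = m := by
      ext i
      simp only [Finsupp.coe_add, Finsupp.coe_tsub, Pi.add_apply, Pi.sub_apply,
        Finsupp.single_apply]
      split_ifs with hi
      · subst hi; omega
      · omega
    rw [hms] at hcoef
    have hc : MvPolynomial.coeff m P ≠ 0 := MvPolynomial.mem_support_iff.mp hm
    have hk : (((m - Finsupp.single (Fin.last 1) 1 : Fin (1 + 1) →₀ ℕ) (Fin.last 1) : ℕ) : ℚ) + 1 ≠ 0 := by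
      positivity
    exact mul_ne_zero hc hk hcoef.symm
  refine ⟨P, hP0, fun x hx => hP x (hKW hx), ?_, ?_⟩
  · by_contra hinf
    exact absurd (hmin Pw hPw0 (aeval_snoc_eq_zero_of_infinite hε hanW Pw hinf)) (not_le.mpr hdeglt)
  · intro x₀ hx₀ hPt
    exact local_of_simple hWo hsaW hanW (hKW hx₀) P hP hPt

end OffFinite

end Summit.KontsevichZagierPeriods.RootDecompRationalCubeDichotomy.Rung29430.NashEtaleLocalOne
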